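import Mathlib
import Summits.ValiantsHypothesis.ValiantsHypothesis.Theorems.DivisionGapPerMultiplesHardStubTorus
import Summits.ValiantsHypothesis.ValiantsHypothesis.Theorems.DivisionGapPerMultiplesHardStubThinCertificate

/-!
# `DivisionGap.PerMultiplesHard` (stmt-ValiantsHypothesis-5068), line `typed-parse-tree-weights`:
the free multihomogeneous (single-typed) normal form of a multiplier
(stub `stub_multihomogeneousNormalForm`, S2)

For every nonzero `h ∈ ℝ≥0[x_ij]` (`n × n` variables) there is a nonzero `h'` with

* `supp h' ⊆ supp h` (`h'` is a sub-sum of `h`);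
* `h'` **single-typed**: all monomials `m` of `h'` have the same type
  `(Finsupp.mapDomain Prod.fst m, Finsupp.mapDomain Prod.snd m)` (row margins, column margins);
* `L⁺(per_n · h') ≤ L⁺(per_n · h)` and `L⁺(h') ≤ L⁺(h)` for the tree's monotone fan-in-two
  `complexity` over `ℝ≥0`.

Mechanism (as in `DivisionGapPerMultiplesHardStubTorus`).  Over `ℝ≥0` top `w`-components are free
(`complexity_topComponent_le`), multiplicative (`topComponent_mul`) and sub-sums
(`support_topComponent_subset`), and `per_n` is homogeneous for each of the `2n` row/column
indicator weights, so `top_w (per · h) = per · top_w h`; iterating over the `2n` weights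
(`List.foldr topComponent`) gives `h' ≠ 0` homogeneous for every row and column indicator weight,
i.e. with constant row sums `∑ j, m (i, j) = (Finsupp.mapDomain Prod.fst m) i` and column sums
`∑ i, m (i, j) = (Finsupp.mapDomain Prod.snd m) j` over `m ∈ supp h'` (the margin identities are
the sibling stub's `ThinCertificate.mapDomain_fst_apply` / `ThinCertificate.mapDomain_snd_apply`).
[folklore]
-/

noncomputable section

open MvPolynomial Literature.Computability.AlgebraicComplexity
open scoped NNReal BigOperators
open Summit.ValiantsHypothesis.ValiantsHypothesis.Theorems.ZeroOneTransfer.Negative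
open Summit.ValiantsHypothesis.ValiantsHypothesis.Theorems.DivisionGap.PerMultiplesHard.Torus

namespace Summit.ValiantsHypothesis.ValiantsHypothesis.Theorems.DivisionGap.PerMultiplesHard.NormalForm

variable {σ : Type*}

/-! ### Iterated top components: support and complexity -/

/-- Iterated top components are sub-sums: their support lies in that of `h`. [folklore] -/
theorem support_foldr_topComponent_subset (ws : List (σ → ℕ)) (h : MvPolynomial σ ℝ≥0) :
    (ws.foldr topComponent h).support ⊆ h.support := by
  induction ws with
  | nil => exact Finset.Subset.refl _
  | cons w ws ih =>
    rw [List.foldr_cons]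
    exact (support_topComponent_subset w _).trans ih

/-- Iterated top components are free: `L⁺(T_ws h) ≤ L⁺(h)`. [folklore] -/
theorem complexity_foldr_topComponent_le (ws : List (σ → ℕ)) (h : MvPolynomial σ ℝ≥0) :
    complexity (ws.foldr topComponent h) ≤ complexity h := by
  induction ws with
  | nil => exact le_rfl
  | cons w ws ih =>
    rw [List.foldr_cons]
    exact (complexity_topComponent_le w _).trans ih

variable {n : ℕ}

/-! ### Torus-homogeneous multipliers at no cost, with support and complexity control -/

-- adapted from DivisionGapPerMultiplesHardStubTorus.exists_torus_multiple_le
/-- **WLOG the multiplier is torus-homogeneous, for free** (strengthened form of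
`Torus.exists_torus_multiple_le`, same construction): for every nonzero `h` the iterated top
component `h₁ := T_ws h` over the `2n` row/column indicator weights is nonzero, a sub-sum of `h`,
has constant row margins and constant column margins on its support, and satisfies
`L⁺(per_n · h₁) ≤ L⁺(per_n · h)` and `L⁺(h₁) ≤ L⁺(h)`. [folklore] -/
theorem exists_torus_multiple_le' (h : MvPolynomial (Fin n × Fin n) ℝ≥0) (hh : h ≠ 0) :
    ∃ h₁ : MvPolynomial (Fin n × Fin n) ℝ≥0, h₁ ≠ 0 ∧ h₁.support ⊆ h.support ∧
      (∀ i, ∀ d₁ ∈ h₁.support, ∀ d₂ ∈ h₁.support, ∑ j, d₁ (i, j) = ∑ j, d₂ (i, j)) ∧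
      (∀ j, ∀ d₁ ∈ h₁.support, ∀ d₂ ∈ h₁.support, ∑ i, d₁ (i, j) = ∑ i, d₂ (i, j)) ∧
      complexity (perPoly (Fin n) ℝ≥0 * h₁) ≤ complexity (perPoly (Fin n) ℝ≥0 * h) ∧
      complexity h₁ ≤ complexity h := by
  classical
  let ws : List (Fin n × Fin n → ℕ) :=
    (List.finRange n).map (fun i v => if v.1 = i then 1 else 0) ++
      (List.finRange n).map (fun j v => if v.2 = j then 1 else 0)
  have hrow_mem : ∀ i : Fin n, (fun v : Fin n × Fin n => if v.1 = i then 1 else 0) ∈ ws :=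
    fun i => List.mem_append_left _ (List.mem_map.2 ⟨i, List.mem_finRange i, rfl⟩)
  have hcol_mem : ∀ j : Fin n, (fun v : Fin n × Fin n => if v.2 = j then 1 else 0) ∈ ws :=
    fun j => List.mem_append_right _ (List.mem_map.2 ⟨j, List.mem_finRange j, rfl⟩)
  refine ⟨ws.foldr topComponent h, foldr_topComponent_ne_zero ws hh,
    support_foldr_topComponent_subset ws h, ?_, ?_, ?_, complexity_foldr_topComponent_le ws h⟩
  · intro i d₁ hd₁ d₂ hd₂
    obtain ⟨m, hm⟩ := isWeightedHomogeneous_foldr_topComponent ws h (hrow_mem i)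
    rw [← weight_rowIndicator i d₁, ← weight_rowIndicator i d₂, hm (mem_support_iff.1 hd₁),
      hm (mem_support_iff.1 hd₂)]
  · intro j d₁ hd₁ d₂ hd₂
    obtain ⟨m, hm⟩ := isWeightedHomogeneous_foldr_topComponent ws h (hcol_mem j)
    rw [← weight_colIndicator j d₁, ← weight_colIndicator j d₂, hm (mem_support_iff.1 hd₁),
      hm (mem_support_iff.1 hd₂)]
  · refine complexity_mul_foldr_topComponent_le ws _ h fun w hw => ?_
    rcases List.mem_append.1 hw with hw' | hw'
    · obtain ⟨i, -, rfl⟩ := List.mem_map.1 hw'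
      exact ⟨1, isWeightedHomogeneous_perPoly_row i⟩
    · obtain ⟨j, -, rfl⟩ := List.mem_map.1 hw'
      exact ⟨1, isWeightedHomogeneous_perPoly_col j⟩

/-! ### The stub -/

/-- **S2 `stub_multihomogeneousNormalForm`** (top forms are free over `ℝ≥0`, and `per_n` is
homogeneous for the `2n` row/column weights): every nonzero `h` has a nonzero single-typed slice
`h'` (`supp h' ⊆ supp h`, all monomials with the same row and column margins, written as the type
`(Finsupp.mapDomain Prod.fst m, Finsupp.mapDomain Prod.snd m)`) with `L(per_n · h') ≤ L(per_n · h)`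
and `L(h') ≤ L(h)`: the iterated top component of `h` over the `2n` row/column indicator weights,
typed by any fixed monomial `m₀` of its (nonempty) support. [folklore] -/
theorem stub_multihomogeneousNormalForm :
    ∀ (n : ℕ) (h : MvPolynomial (Fin n × Fin n) NNReal), h ≠ 0 →
      ∃ h' : MvPolynomial (Fin n × Fin n) NNReal, h' ≠ 0 ∧ h'.support ⊆ h.support ∧
        (∃ τ : (Fin n →₀ ℕ) × (Fin n →₀ ℕ),
          ∀ m ∈ h'.support, (Finsupp.mapDomain Prod.fst m, Finsupp.mapDomain Prod.snd m) = τ) ∧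
        Literature.Computability.AlgebraicComplexity.complexity
            (Literature.Computability.AlgebraicComplexity.perPoly (Fin n) NNReal * h') ≤
          Literature.Computability.AlgebraicComplexity.complexity
            (Literature.Computability.AlgebraicComplexity.perPoly (Fin n) NNReal * h) ∧
        Literature.Computability.AlgebraicComplexity.complexity h' ≤
          Literature.Computability.AlgebraicComplexity.complexity h := by
  intro n h hh
  obtain ⟨h₁, h₁0, hsupp, hrow, hcol, hL, hL'⟩ := exists_torus_multiple_le' h hh
  obtain ⟨m₀, hm₀⟩ := support_nonempty.2 h₁0
  refine ⟨h₁, h₁0, hsupp,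
    ⟨(Finsupp.mapDomain Prod.fst m₀, Finsupp.mapDomain Prod.snd m₀), fun m hm => ?_⟩, hL, hL'⟩
  refine Prod.ext ?_ ?_
  · ext i
    rw [ThinCertificate.mapDomain_fst_apply, ThinCertificate.mapDomain_fst_apply]
    exact hrow i m hm m₀ hm₀
  · ext j
    rw [ThinCertificate.mapDomain_snd_apply, ThinCertificate.mapDomain_snd_apply]
    exact hcol j m hm m₀ hm₀

end Summit.ValiantsHypothesis.ValiantsHypothesis.Theorems.DivisionGap.PerMultiplesHard.NormalForm

end
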